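import Summits.QuantumFields.BalabanUV.T4Continuum.Spine.NE1p.DressedRebornMuResponse

/-!
# T⁴ programme, spine estimate NE1′ (node O3b/H2) — WITNESS «THE SCHWARZ-ITERATED CONSTANT 4 OF THE RE-BORN μ-PART IS SHARP»:
# S56 §1 `rebornMuPart_le_of_bidisc` bounds the mixed difference of an `M`-bounded holomorphic `E` on the (source, strength) bidisc
# over `{0, μ} × {0, 1}` by `2·(2·M∕μ₁·‖μ‖)∕ε·σ = 4·((M∕μ₁)‖μ‖)(σ∕ε)`; on the Blaschke-product datum `E(z) = M·b_a(z₁∕μ₁)·b_a(z₂σ∕ε)`,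
# `b_a(w) = (w − a)∕(1 − a w)`, the mixed difference FACTORS as `M·(b_a(μ∕μ₁) + a)(b_a(σ∕ε) + a)` and along `σ∕ε = μ∕μ₁ = a(2 − a)`,
# `a ↑ 1`, its ratio to `(M∕μ₁)‖μ‖(σ∕ε)` is `((1 + a)∕(1 + a − a²))² ↑ 4` — so NO constant `c < 4` can replace S56 §1's, and `4`
# itself serves: the constant of record is OPTIMAL on the abstract SHAPE (a (t7)-style separation record for this unit's S56 column)

Cell `pub-balaban`, sub-cell `t4`, row NE1′ formalisation crew (`t4/formal/NE1p/LEAVES.md` row W108 ∕ DAG N29zzzzzz, BOOKED typer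
R-T156, read X256 ok; INTENT `HOME/CLAIMS.log`
2026-08-21), unit `b2b-balaban-t4-ne1p-formalise-leaf-03` (LEAF PROVER 03, gen 15; S56 ∕ S61's author lineage).  ADDITIVE — imports S61
`Spine/NE1p/DressedRebornMuResponse` (→ S56 `DressedRebornMuPart` → the owner's N0g `DressedSmallFieldAllowance`) ONLY; TWO toy-DATA `def`s
(`blaschke`, `mobProd` — the datum) + theorems; 0 `def … : Prop`, 0 cite, 0 sorry; nothing of S56 ∕ S61 ∕ N0g restated —
`rebornMuPart_le_of_bidisc` (S56 §1) and `rebornMuDeriv_le_of_bidisc` (S61 §1) are APPLIED ONCE EACH BY NAME (§2) and S56 §1 once more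
inside `four_serves` (§5, its re-typing in the no-go's quantifier shape).

WHY.  S56 §1 (this lineage, g14) is the SIZE face of the dressed (w5) END at the abstract level: Schwarz in the source (`2M∕μ₁·‖μ‖`, N0g
`norm_sub_le_of_ball`) then the owner's `regen_le_of_slack` in the strength (`2·B∕ε·σ`) — two factors `2`, constant `4`.  Every by-name
descendant (S56 §2∕§3 exp-linear ∕ cores, S63 letters, S64 torus, the witnesses W84 ∕ W86 ∕ W87) inherits `4M∕(μ₁ε)` as the READING of
the dressed regeneration constant.  Whether a sharper bookkeeping could lower the `4` on the SHAPE ALONE was open (X93 INFO-2 asked it of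
N0g's single Schwarz step; leaf-06's «THIRD RADIUS IS NOT FOR SALE» settles N0g §2's window quotient).  Here, for the ITERATED step:
* §1 the datum — `blaschke`, `mobProd`; [folklore] `pick_identity` (`‖1 − a w‖² − ‖w − a‖² = (1 − a²)(1 − ‖w‖²)`), `norm_blaschke_le_one`
  on the open unit disc for `0 ≤ a < 1`, `blaschke_add_eq` (`b_a(w) + a = w(1 − a²)∕(1 − a w)`), holomorphy and the bound `‖E‖ ≤ M` on
  the bidisc (`differentiableOn_mobProd`, `norm_mobProd_le`);
* §2 **`rebornEnd_fires`** — S56 §1 APPLIED ONCE BY NAME on the datum (strength radius `ε∕σ`), conclusion LITERAL; **`responseEnd_fires`** —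
  S61 §1 APPLIED ONCE BY NAME on the same datum (window `‖μ‖ ≤ μ₀ < μ₁`), conclusion LITERAL;
* §3 GENUINE — `mixedDiff_eq_mul` ∕ `mixedDiff_eq`: the mixed difference over `{0, μ} × {0, 1}` in CLOSED FORM;
* §4 the located family `M = μ₁ = ε = 1`, `σ = μ = t := a(2 − a)` (`t_mem`: `t ∈ (0,1)`; `family_ratio`: `1 − a t = (1 − a)(1 + a − a²)`):
  **`norm_mixedDiff_family`** `‖Δ‖ = (t(1 + a)∕(1 + a − a²))²` EXACTLY; `tendsto_family_ratio`: `((1 + a)∕(1 + a − a²))² → 4` as `a ↑ 1`;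
* §5 **`four_is_sharp`** (`∀ c < 4`, a datum meeting EVERY hypothesis of S56 §1 with `c·((M∕μ₁)‖μ‖)∕ε·σ <` its mixed difference —
  `Filter.Tendsto.eventually_const_lt` on `𝓝[<] 1` picks the parameter), **`no_constant_below_four`** (the universally quantified bound
  with `c` in place of `2·2` is FALSE for every `c < 4`), **`four_serves`** (S56 §1 re-typed in that quantifier shape: `4` holds) — together:
  `4` is the OPTIMAL constant of S56 §1; the located `example` (`a = ½`, `t = ¾`: `‖Δ‖ = 81∕100 = 1.44·t²` against `4·t²`).

WHAT THIS SAYS AND DOES NOT SAY.  A statement about the abstract SHAPE «`M`-bounded holomorphic function of (source, strength) on a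
bidisc» — the hypothesis class of S56 §1 — and about OUR constant: within that class the Schwarz-iterated `4` cannot be improved.  It does
NOT say the dressed (w5) constant of Bałaban's densities is `4M∕(μ₁ε)` (the densities may sit far inside the class), nor that (w5) holds:
(w5)∕(w6) are NOT discharged on Bałaban's densities; the extremal datum is a Möbius product of OUR choosing, not a cluster expansion term.
S61 §1's response constant `4Mσ∕(ε(μ₁ − μ₀))` is exercised (§2) but its sharpness is NOT claimed here (the window quotient's necessity is
leaf-06's N0g-level record; the product datum does not saturate it).

HONEST FRAMING.  A DECIDED TOY ([folklore] one-variable complex algebra — Pick's identity, Blaschke factors, `div_le_one`; Mathlib's order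
topology for the limit `a ↑ 1`; 0 sorry; 0 citations; no `def … : Prop`); S56 §1 ∕ S61 §1 BY NAME; no numeral of [Balaban1988RGII] or any
audited manuscript; 0 binders instantiated on Bałaban's densities; no wall item; the NE1′ wall wording of record v1.8 (T4-DAG v48; v49–v51
carry it verbatim) — words, not kind — does NOT move; R-t4r2-Q2 NOT met thereby; no internally-minted statement becomes a cited fact
(ABSOLUTE RULE).  NE1′ ⇐ the named binders — NOT proved, NOT printed; spine PROVED 0∕9; count 9 unchanged.  Rung (B)+1 on ONE finite
four-torus — NOT infinite volume, NOT a mass gap, NOT OS on ℝ⁴, NOT Clay.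
HONEST DEPENDENCY: continuum YM on T⁴ ⇐ BetaPertH ∧ nine spine estimates (0/9 proved); BetaPertH ⇐ (D1) ∧ (D4) ∧ CAP+tail; G-an2-4
gates asym, D1 and NE2/3/4.
-/

noncomputable section

namespace Summit.QuantumFields.BalabanUV.T4Continuum.NE1p.DressedRebornMuPartSharpnessWitness

open Metric Set Complex Filter
open scoped Topology
open Summit.QuantumFields.BalabanUV.T4Continuum.NE1p.DressedRebornMuPart (rebornMuPart_le_of_bidisc)
open Summit.QuantumFields.BalabanUV.T4Continuum.NE1p.DressedRebornMuResponse (rebornMuDeriv_le_of_bidisc)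

/-! ## §1 THE DATUM: a product of two Blaschke factors, one in the source and one in the strength -/

/-- Toy DATA: the Blaschke factor `b_a(w) = (w − a)∕(1 − a·w)` of the unit disc with real parameter `a`. -/
def blaschke (a : ℝ) (w : ℂ) : ℂ := (w - a) / (1 - a * w)

/-- Toy DATA: `E(z) = M · b_a(z₁∕μ₁) · b_a(z₂∕ρ)` on the (source, strength) bidisc `ball 0 μ₁ ×ˢ ball 0 ρ`. -/
def mobProd (M μ₁ ρ a : ℝ) (z : ℂ × ℂ) : ℂ := M * blaschke a (z.1 / μ₁) * blaschke a (z.2 / ρ)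

/-- The Pick-type identity behind `|b_a| ≤ 1`: `‖1 − a w‖² − ‖w − a‖² = (1 − a²)(1 − ‖w‖²)`. [folklore] -/
theorem pick_identity (a : ℝ) (w : ℂ) : ‖(1 : ℂ) - a * w‖ ^ 2 - ‖w - a‖ ^ 2 = (1 - a ^ 2) * (1 - ‖w‖ ^ 2) := by
  simp only [Complex.sq_norm, Complex.normSq_apply, Complex.sub_re, Complex.sub_im, Complex.mul_re, Complex.mul_im,
    Complex.one_re, Complex.one_im, Complex.ofReal_re, Complex.ofReal_im]
  ring

/-- On the open unit disc the denominator of `b_a` does not vanish (`0 ≤ a < 1`). [folklore] -/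
theorem one_sub_mul_ne_zero {a : ℝ} (ha0 : 0 ≤ a) (ha1 : a < 1) {w : ℂ} (hw : ‖w‖ < 1) : (1 : ℂ) - a * w ≠ 0 := by
  intro h
  have h1 : (a : ℂ) * w = 1 := by linear_combination -h
  have h2 : ‖(a : ℂ) * w‖ = 1 := by rw [h1, norm_one]
  rw [norm_mul, Complex.norm_real, Real.norm_eq_abs, abs_of_nonneg ha0] at h2
  nlinarith [norm_nonneg w]

/-- `|b_a(w)| ≤ 1` on the open unit disc (`0 ≤ a < 1`). [folklore] -/
theorem norm_blaschke_le_one {a : ℝ} (ha0 : 0 ≤ a) (ha1 : a < 1) {w : ℂ} (hw : ‖w‖ < 1) : ‖blaschke a w‖ ≤ 1 := by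
  have hden : (1 : ℂ) - a * w ≠ 0 := one_sub_mul_ne_zero ha0 ha1 hw
  rw [blaschke, norm_div, div_le_one (norm_pos_iff.2 hden)]
  have hid := pick_identity a w
  have hnn : 0 ≤ (1 - a ^ 2) * (1 - ‖w‖ ^ 2) := by
    apply mul_nonneg <;> nlinarith [norm_nonneg w]
  have hsq : ‖w - a‖ ^ 2 ≤ ‖(1 : ℂ) - a * w‖ ^ 2 := by linarith
  exact le_of_sq_le_sq hsq (norm_nonneg _)

/-- `b_a(0) = −a`. -/
theorem blaschke_zero (a : ℝ) : blaschke a 0 = -a := by simp [blaschke]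

/-- `b_a(w) − b_a(0) = b_a(w) + a = w(1 − a²)∕(1 − a w)`. [folklore] -/
theorem blaschke_add_eq (a : ℝ) {w : ℂ} (h : (1 : ℂ) - a * w ≠ 0) :
    blaschke a w + a = w * (1 - a ^ 2) / (1 - a * w) := by
  rw [blaschke, div_add' _ _ _ h]
  congr 1
  ring

/-- `b_a` is holomorphic on the open unit disc. [folklore] -/
theorem differentiableOn_blaschke {a : ℝ} (ha0 : 0 ≤ a) (ha1 : a < 1) : DifferentiableOn ℂ (blaschke a) (ball (0 : ℂ) 1) :=
  fun _ hw => (((differentiableAt_id.sub_const (a : ℂ)).div ((differentiableAt_const (1 : ℂ)).sub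
    ((differentiableAt_const (a : ℂ)).mul differentiableAt_id)) (one_sub_mul_ne_zero ha0 ha1 (mem_ball_zero_iff.1 hw)))).differentiableWithinAt

/-- Scaling a disc of radius `r > 0` into the unit disc. -/
theorem norm_div_lt_one {r : ℝ} (hr : 0 < r) {w : ℂ} (hw : w ∈ ball (0 : ℂ) r) : ‖w / r‖ < 1 := by
  rw [norm_div, Complex.norm_real, Real.norm_eq_abs, abs_of_pos hr, div_lt_one hr]
  exact mem_ball_zero_iff.1 hw

/-- The datum is holomorphic on the bidisc. [folklore] -/
theorem differentiableOn_mobProd {M μ₁ ρ a : ℝ} (hμ₁ : 0 < μ₁) (hρ : 0 < ρ) (ha0 : 0 ≤ a) (ha1 : a < 1) :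
    DifferentiableOn ℂ (mobProd M μ₁ ρ a) (ball (0 : ℂ) μ₁ ×ˢ ball (0 : ℂ) ρ) := by
  have hb := differentiableOn_blaschke ha0 ha1
  have hf1 : DifferentiableOn ℂ (fun z : ℂ × ℂ => z.1 / (μ₁ : ℂ)) (ball (0 : ℂ) μ₁ ×ˢ ball (0 : ℂ) ρ) :=
    by fun_prop
  have hf2 : DifferentiableOn ℂ (fun z : ℂ × ℂ => z.2 / (ρ : ℂ)) (ball (0 : ℂ) μ₁ ×ˢ ball (0 : ℂ) ρ) :=
    by fun_prop
  have h1 : DifferentiableOn ℂ (fun z : ℂ × ℂ => blaschke a (z.1 / μ₁)) (ball (0 : ℂ) μ₁ ×ˢ ball (0 : ℂ) ρ) :=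
    hb.comp hf1 fun z hz => mem_ball_zero_iff.2 (norm_div_lt_one hμ₁ hz.1)
  have h2 : DifferentiableOn ℂ (fun z : ℂ × ℂ => blaschke a (z.2 / ρ)) (ball (0 : ℂ) μ₁ ×ˢ ball (0 : ℂ) ρ) :=
    hb.comp hf2 fun z hz => mem_ball_zero_iff.2 (norm_div_lt_one hρ hz.2)
  exact ((differentiableOn_const (M : ℂ)).mul h1).mul h2

/-- The datum is bounded by `M` on the bidisc (`0 ≤ M`). [folklore] -/
theorem norm_mobProd_le {M μ₁ ρ a : ℝ} (hM : 0 ≤ M) (hμ₁ : 0 < μ₁) (hρ : 0 < ρ) (ha0 : 0 ≤ a) (ha1 : a < 1) :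
    ∀ z ∈ ball (0 : ℂ) μ₁ ×ˢ ball (0 : ℂ) ρ, ‖mobProd M μ₁ ρ a z‖ ≤ M := by
  intro z hz
  have h1 : ‖blaschke a (z.1 / μ₁)‖ ≤ 1 := norm_blaschke_le_one ha0 ha1 (norm_div_lt_one hμ₁ hz.1)
  have h2 : ‖blaschke a (z.2 / ρ)‖ ≤ 1 := norm_blaschke_le_one ha0 ha1 (norm_div_lt_one hρ hz.2)
  rw [mobProd, norm_mul, norm_mul, Complex.norm_real, Real.norm_eq_abs, abs_of_nonneg hM]
  calc M * ‖blaschke a (z.1 / ↑μ₁)‖ * ‖blaschke a (z.2 / ↑ρ)‖ ≤ M * 1 * 1 := by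
        gcongr
    _ = M := by ring

/-! ## §2 S56 §1 AND S61 §1 FIRE ON THE DATUM -/

/-- **S56 §1 `rebornMuPart_le_of_bidisc` FIRES ON THE BLASCHKE-PRODUCT DATUM** (strength radius `ρ := ε∕σ`): the mixed difference over
`{0, μ} × {0, 1}` is `≤ 2·((2M∕μ₁)·‖μ‖)∕ε·σ`. [folklore] -/
theorem rebornEnd_fires {M μ₁ σ ε a : ℝ} (hM : 0 ≤ M) (hμ₁ : 0 < μ₁) (hσ : 0 < σ) (hσε : σ < ε) (ha0 : 0 ≤ a)
    (ha1 : a < 1) {μ : ℂ} (hμ : μ ∈ ball (0 : ℂ) μ₁) :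
    ‖mobProd M μ₁ (ε / σ) a (μ, 1) - mobProd M μ₁ (ε / σ) a (0, 1) -
        (mobProd M μ₁ (ε / σ) a (μ, 0) - mobProd M μ₁ (ε / σ) a (0, 0))‖ ≤ 2 * (2 * M / μ₁ * ‖μ‖) / ε * σ :=
  rebornMuPart_le_of_bidisc hσ hσε (differentiableOn_mobProd hμ₁ (div_pos (hσ.trans hσε) hσ) ha0 ha1)
    (norm_mobProd_le hM hμ₁ (div_pos (hσ.trans hσε) hσ) ha0 ha1) hμ

/-- **S61 §1 `rebornMuDeriv_le_of_bidisc` FIRES ON THE SAME DATUM**: on the window `‖μ‖ ≤ μ₀ < μ₁` the source derivative of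
`m ↦ E(m,1) − E(m,0)` is `≤ 2·((2M∕ε)·σ)∕(μ₁ − μ₀)`. [folklore] -/
theorem responseEnd_fires {M μ₁ μ₀ σ ε a : ℝ} (hM : 0 ≤ M) (hμ₁ : 0 < μ₁) (hσ : 0 < σ) (hσε : σ < ε) (ha0 : 0 ≤ a)
    (ha1 : a < 1) (h01 : μ₀ < μ₁) {μ : ℂ} (hμ : ‖μ‖ ≤ μ₀) :
    ‖deriv (fun m : ℂ => mobProd M μ₁ (ε / σ) a (m, 1) - mobProd M μ₁ (ε / σ) a (m, 0)) μ‖ ≤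
      2 * (2 * M / ε * σ) / (μ₁ - μ₀) :=
  rebornMuDeriv_le_of_bidisc hσ hσε (differentiableOn_mobProd hμ₁ (div_pos (hσ.trans hσε) hσ) ha0 ha1)
    (norm_mobProd_le hM hμ₁ (div_pos (hσ.trans hσε) hσ) ha0 ha1) h01 hμ

/-! ## §3 GENUINE — THE MIXED DIFFERENCE OF THE DATUM IN CLOSED FORM -/

/-- The mixed difference of `E = M·b_a(z₁∕μ₁)·b_a(z₂∕ρ)` over `{0, μ} × {0, 1}` FACTORS:
`M·(b_a(μ∕μ₁) + a)·(b_a(1∕ρ) + a)`. [folklore] -/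
theorem mixedDiff_eq_mul (M μ₁ ρ a : ℝ) (μ : ℂ) :
    mobProd M μ₁ ρ a (μ, 1) - mobProd M μ₁ ρ a (0, 1) - (mobProd M μ₁ ρ a (μ, 0) - mobProd M μ₁ ρ a (0, 0)) =
      M * (blaschke a (μ / μ₁) + a) * (blaschke a (1 / ρ) + a) := by
  simp only [mobProd, zero_div, blaschke_zero]
  ring

/-- … hence, inside the bidisc, `= M · (μ∕μ₁)(1 − a²)∕(1 − aμ∕μ₁) · (1∕ρ)(1 − a²)∕(1 − a∕ρ)`. [folklore] -/
theorem mixedDiff_eq {M μ₁ ρ a : ℝ} {μ : ℂ} (h1 : (1 : ℂ) - a * (μ / μ₁) ≠ 0) (h2 : (1 : ℂ) - a * (1 / ρ) ≠ 0) :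
    mobProd M μ₁ ρ a (μ, 1) - mobProd M μ₁ ρ a (0, 1) - (mobProd M μ₁ ρ a (μ, 0) - mobProd M μ₁ ρ a (0, 0)) =
      M * (μ / μ₁ * (1 - a ^ 2) / (1 - a * (μ / μ₁))) * (1 / ρ * (1 - a ^ 2) / (1 - a * (1 / ρ))) := by
  rw [mixedDiff_eq_mul, blaschke_add_eq a h1, blaschke_add_eq a h2]

/-! ## §4 THE LOCATED ONE-PARAMETER FAMILY: `a ∈ (0,1)`, `M = μ₁ = ε = 1`, `σ = μ = t := a(2 − a)` -/

/-- The family's point `t = a(2 − a) = 1 − (1 − a)²` lies in `(0, 1)` for `a ∈ (0, 1)`. -/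
theorem t_mem {a : ℝ} (ha0 : 0 < a) (ha1 : a < 1) : 0 < a * (2 - a) ∧ a * (2 - a) < 1 :=
  ⟨by nlinarith, by nlinarith⟩

/-- The family's algebra: `1 − a·t = (1 − a)(1 + a − a²)` and `1 − a² = (1 − a)(1 + a)`, so
`t(1 − a²)∕(1 − a t) = t(1 + a)∕(1 + a − a²)`. -/
theorem family_ratio {a : ℝ} (ha0 : 0 < a) (ha1 : a < 1) :
    a * (2 - a) * (1 - a ^ 2) / (1 - a * (a * (2 - a))) = a * (2 - a) * (1 + a) / (1 + a - a ^ 2) := by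
  have h1 : (1 : ℝ) - a ≠ 0 := by intro h; linarith
  have h2 : (1 : ℝ) + a - a ^ 2 ≠ 0 := by nlinarith
  have h3 : (1 : ℝ) - a * (a * (2 - a)) = (1 - a) * (1 + a - a ^ 2) := by ring
  rw [h3, show (1 : ℝ) - a ^ 2 = (1 - a) * (1 + a) by ring]
  field_simp

/-- **THE MIXED DIFFERENCE OF THE FAMILY, EXACTLY**: with `t = a(2 − a)`,
`‖Δ‖ = (t·(1 + a)∕(1 + a − a²))²` — against S56 §1's bound `4·t·t` (`M = μ₁ = ε = 1`, `σ = ‖μ‖ = t`). [folklore] -/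
theorem norm_mixedDiff_family {a : ℝ} (ha0 : 0 < a) (ha1 : a < 1) :
    ‖mobProd 1 1 (1 / (a * (2 - a))) a ((a * (2 - a) : ℝ), 1) - mobProd 1 1 (1 / (a * (2 - a))) a (0, 1) -
        (mobProd 1 1 (1 / (a * (2 - a))) a ((a * (2 - a) : ℝ), 0) - mobProd 1 1 (1 / (a * (2 - a))) a (0, 0))‖ =
      (a * (2 - a) * (1 + a) / (1 + a - a ^ 2)) ^ 2 := by
  obtain ⟨ht0, ht1⟩ := t_mem ha0 ha1
  have hta : ‖((a * (2 - a) : ℝ) : ℂ)‖ < 1 := by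
    rw [Complex.norm_real, Real.norm_eq_abs, abs_of_pos ht0]; exact ht1
  have hq1 : ((a * (2 - a) : ℝ) : ℂ) / ((1 : ℝ) : ℂ) = ((a * (2 - a) : ℝ) : ℂ) := by
    rw [Complex.ofReal_one, div_one]
  have hq2 : (1 : ℂ) / (((1 / (a * (2 - a)) : ℝ)) : ℂ) = ((a * (2 - a) : ℝ) : ℂ) := by
    rw [Complex.ofReal_div, Complex.ofReal_one, one_div_one_div]
  have hden : (1 : ℂ) - a * ((a * (2 - a) : ℝ) : ℂ) ≠ 0 := one_sub_mul_ne_zero ha0.le ha1 hta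
  have h1 : (1 : ℂ) - a * (((a * (2 - a) : ℝ) : ℂ) / ((1 : ℝ) : ℂ)) ≠ 0 := by rw [hq1]; exact hden
  have h2 : (1 : ℂ) - a * ((1 : ℂ) / (((1 / (a * (2 - a)) : ℝ)) : ℂ)) ≠ 0 := by rw [hq2]; exact hden
  rw [mixedDiff_eq h1 h2, hq1, hq2]
  -- the one real letter `r = t(1 − a²)∕(1 − a t) = t(1 + a)∕(1 + a − a²)`
  have hden' : (1 : ℂ) - (a : ℂ) * ((a : ℂ) * (2 - (a : ℂ))) ≠ 0 := by
    have h := hden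
    push_cast at h
    exact h
  have hne : (1 : ℂ) + (a : ℂ) - (a : ℂ) ^ 2 ≠ 0 := by
    have h : ((1 + a - a ^ 2 : ℝ) : ℂ) ≠ 0 := by
      have hr : (1 : ℝ) + a - a ^ 2 ≠ 0 := by nlinarith
      exact_mod_cast hr
    push_cast at h
    exact h
  have hr : ((a * (2 - a) : ℝ) : ℂ) * (1 - (a : ℂ) ^ 2) / (1 - a * ((a * (2 - a) : ℝ) : ℂ)) =
      (((a * (2 - a) * (1 + a) / (1 + a - a ^ 2)) : ℝ) : ℂ) := by
    push_cast
    rw [div_eq_div_iff hden' hne]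
    ring
  rw [hr, Complex.ofReal_one, one_mul, ← Complex.ofReal_mul, Complex.norm_real, Real.norm_eq_abs, ← sq,
    abs_of_nonneg (sq_nonneg _)]

/-- The family's ratio to the bilinear unit: `g(a) = ((1 + a)∕(1 + a − a²))²`, continuous at `a = 1` with `g(1) = 4`. -/
theorem tendsto_family_ratio :
    Tendsto (fun a : ℝ => ((1 + a) / (1 + a - a ^ 2)) ^ 2) (𝓝[<] (1 : ℝ)) (𝓝 4) := by
  have hc : ContinuousAt (fun a : ℝ => ((1 + a) / (1 + a - a ^ 2)) ^ 2) 1 := by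
    have hd : (1 : ℝ) + 1 - 1 ^ 2 ≠ 0 := by norm_num
    fun_prop (disch := exact hd)
  have h4 : ((1 + (1 : ℝ)) / (1 + 1 - 1 ^ 2)) ^ 2 = 4 := by norm_num
  rw [← h4]
  exact hc.tendsto.mono_left nhdsWithin_le_nhds

/-! ## §5 THE CONSTANT 4 IS SHARP -/

/-- **THE SCHWARZ-ITERATED CONSTANT `4 = 2·2` OF S56 §1 IS SHARP** [decided toy]: for every `c < 4` there is a datum satisfying EVERY
hypothesis of `rebornMuPart_le_of_bidisc` (holomorphic on the bidisc `ball 0 μ₁ ×ˢ ball 0 (ε∕σ)`, bounded by `M` there, `0 < σ < ε`,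
`μ ∈ ball 0 μ₁`) whose mixed difference over `{0, μ} × {0, 1}` EXCEEDS `c·((M∕μ₁)·‖μ‖)∕ε·σ` — the Blaschke-product family at
`M = μ₁ = ε = 1`, `σ = μ = a(2 − a)`, `a ↑ 1`.  No constant below `4` serves in S56 §1 (nor, a fortiori, in its by-name descendants
S56 §2∕§3, S63, S64 on data that realise this shape). [folklore] -/
theorem four_is_sharp {c : ℝ} (hc : c < 4) :
    ∃ (E : ℂ × ℂ → ℂ) (M μ₁ σ ε : ℝ) (μ : ℂ), 0 < σ ∧ σ < ε ∧
      DifferentiableOn ℂ E (ball (0 : ℂ) μ₁ ×ˢ ball (0 : ℂ) (ε / σ)) ∧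
      (∀ z ∈ ball (0 : ℂ) μ₁ ×ˢ ball (0 : ℂ) (ε / σ), ‖E z‖ ≤ M) ∧ μ ∈ ball (0 : ℂ) μ₁ ∧
      c * (M / μ₁ * ‖μ‖) / ε * σ < ‖E (μ, 1) - E (0, 1) - (E (μ, 0) - E (0, 0))‖ := by
  -- pick `a ∈ (0,1)` close to `1` with `c < g(a)`
  have hev : ∀ᶠ a in 𝓝[<] (1 : ℝ), c < ((1 + a) / (1 + a - a ^ 2)) ^ 2 ∧ a ∈ Ioo (0 : ℝ) 1 :=
    (tendsto_family_ratio.eventually_const_lt hc).and (Ioo_mem_nhdsLT zero_lt_one)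
  obtain ⟨a, hca, ha0, ha1⟩ := hev.exists
  obtain ⟨ht0, ht1⟩ := t_mem ha0 ha1
  refine ⟨mobProd 1 1 (1 / (a * (2 - a))) a, 1, 1, a * (2 - a), 1, ((a * (2 - a) : ℝ) : ℂ), ht0, ht1,
    differentiableOn_mobProd one_pos (by positivity) ha0.le ha1, norm_mobProd_le zero_le_one one_pos (by positivity) ha0.le ha1,
    ?_, ?_⟩
  · rw [mem_ball_zero_iff, Complex.norm_real, Real.norm_eq_abs, abs_of_pos ht0]; exact ht1
  · rw [norm_mixedDiff_family ha0 ha1, Complex.norm_real, Real.norm_eq_abs, abs_of_pos ht0]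
    have ht2 : 0 < (a * (2 - a)) ^ 2 := by positivity
    calc c * (1 / 1 * (a * (2 - a))) / 1 * (a * (2 - a)) = c * (a * (2 - a)) ^ 2 := by ring
      _ < ((1 + a) / (1 + a - a ^ 2)) ^ 2 * (a * (2 - a)) ^ 2 := mul_lt_mul_of_pos_right hca ht2
      _ = (a * (2 - a) * (1 + a) / (1 + a - a ^ 2)) ^ 2 := by ring

/-- **… so NO constant below 4 can replace S56 §1's**: the universally quantified bound with `c` in place of `2·2` FAILS for every
`c < 4`. [folklore] -/
theorem no_constant_below_four {c : ℝ} (hc : c < 4) :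
    ¬ ∀ (E : ℂ × ℂ → ℂ) (M μ₁ σ ε : ℝ) (μ : ℂ), 0 < σ → σ < ε →
      DifferentiableOn ℂ E (ball (0 : ℂ) μ₁ ×ˢ ball (0 : ℂ) (ε / σ)) →
      (∀ z ∈ ball (0 : ℂ) μ₁ ×ˢ ball (0 : ℂ) (ε / σ), ‖E z‖ ≤ M) → μ ∈ ball (0 : ℂ) μ₁ →
      ‖E (μ, 1) - E (0, 1) - (E (μ, 0) - E (0, 0))‖ ≤ c * (M / μ₁ * ‖μ‖) / ε * σ := by
  intro h
  obtain ⟨E, M, μ₁, σ, ε, μ, hσ, hσε, hd, hM, hμ, hlt⟩ := four_is_sharp hc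
  exact absurd (h E M μ₁ σ ε μ hσ hσε hd hM hμ) (not_le.2 hlt)

/-- **AND 4 ITSELF SERVES** — S56 §1 re-typed in the same quantifier shape (`2·(2·M∕μ₁·‖μ‖)∕ε·σ = 4·((M∕μ₁)·‖μ‖)∕ε·σ`): the
constant of record is the OPTIMAL one. [folklore] -/
theorem four_serves :
    ∀ (E : ℂ × ℂ → ℂ) (M μ₁ σ ε : ℝ) (μ : ℂ), 0 < σ → σ < ε →
      DifferentiableOn ℂ E (ball (0 : ℂ) μ₁ ×ˢ ball (0 : ℂ) (ε / σ)) →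
      (∀ z ∈ ball (0 : ℂ) μ₁ ×ˢ ball (0 : ℂ) (ε / σ), ‖E z‖ ≤ M) → μ ∈ ball (0 : ℂ) μ₁ →
      ‖E (μ, 1) - E (0, 1) - (E (μ, 0) - E (0, 0))‖ ≤ 4 * (M / μ₁ * ‖μ‖) / ε * σ := by
  intro E M μ₁ σ ε μ hσ hσε hd hM hμ
  have h := rebornMuPart_le_of_bidisc hσ hσε hd hM hμ
  calc ‖E (μ, 1) - E (0, 1) - (E (μ, 0) - E (0, 0))‖ ≤ 2 * (2 * M / μ₁ * ‖μ‖) / ε * σ := h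
    _ = 4 * (M / μ₁ * ‖μ‖) / ε * σ := by ring

/-- **LOCATED** [decided]: at `a = ½` (`t = ¾`, `M = μ₁ = ε = 1`, `σ = μ = ¾`) the mixed difference is EXACTLY `(¾·(3∕2)∕(5∕4))² =
81∕100`, i.e. `1.44 × t²` against S56 §1's `4 × t² = 9∕4`; at `a = 9∕10` it is `(0.99·1.9∕1.09)²`, ratio `≈ 3.04`. -/
example :
    ‖mobProd 1 1 (1 / ((1 / 2 : ℝ) * (2 - 1 / 2))) (1 / 2) ((((1 / 2 : ℝ) * (2 - 1 / 2) : ℝ)), 1) -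
          mobProd 1 1 (1 / ((1 / 2 : ℝ) * (2 - 1 / 2))) (1 / 2) (0, 1) -
        (mobProd 1 1 (1 / ((1 / 2 : ℝ) * (2 - 1 / 2))) (1 / 2) ((((1 / 2 : ℝ) * (2 - 1 / 2) : ℝ)), 0) -
          mobProd 1 1 (1 / ((1 / 2 : ℝ) * (2 - 1 / 2))) (1 / 2) (0, 0))‖ = 81 / 100 := by
  rw [norm_mixedDiff_family (a := 1 / 2) (by norm_num) (by norm_num)]
  norm_num

end Summit.QuantumFields.BalabanUV.T4Continuum.NE1p.DressedRebornMuPartSharpnessWitness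

end
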